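import Summits.Ventures.Crystal3D.Theorems.StickyWulffConstantGenericWallFloorEndBallClassOps
import Summits.Ventures.Crystal3D.Theorems.StickyWulffConstantGenericWallFloorEndBallClassG1
import HarnessLib

/-!
# §51 interface — WORKED EXAMPLES II: one «occupied ⇒ C′» step on G1 in kernel, and class G2 through the A₂ FRAME RULE
# (crux `GenericWallFloor`, stmt-Ventures-19480, line `WallLedgerG`; cf-p1 2026-08-28T21:40Z «one class fully through the kernel, including
# one 'occupied ⇒ C′' step; then the A₂ frame rule»)

HONEST FRAMING. Venture `Summits/Ventures/Crystal3D` (cell `crystal3d-full`), helper for the crux `GenericWallFloor` of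
`route-Ventures-StickyWulffConstant`, REGISTERED line `WallLedgerG`, open stub `stub_twoSlabAdhesion`.  TEMPLATES for cf-p2's per-class glue;
one definition (`endBallClassG2T`, class G2 = `q3G2` of …ShellRowCertDefs in interface format, T-coordinates) + kernel evaluations
(`decide +kernel`, default heartbeats) + instantiated theorems.  Shell rows enter as the hypothesis `deg z ≤ 8` (`shellRow_G1/_G2`,
computational grade, …ShellRowCert).  Rung credit only; F-C1 not moved.

* §1 G1, ONE STEP: site `(−4,−4,−4)` (a free cube site at `√(8/3)`) OCCUPIED ⇒ class `endBallClassG1.addOwn (−4,−4,−4)`;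
  **`freeSites_G1_step`**: its free table = 16 sites (the other 19 minus the three `√3`-sites `(−6,−3,−3), (−3,−6,−3), (−3,−3,−6)` that
  overlap the new ball), evaluated in kernel; **`universe_G1_step`**: the universe theorem for such carriers.  (Pilot statistics,
  HOME/wall-p1-g11/pilot_stats.py: iterating this over all free sites of G1 visits 104 976 terminal configurations — the free sites are
  almost independent — so the √3-radius site recursion is NOT the object to enumerate; cf-p1 to rule on the radius / verdict coarsening.)
* §2 G2 THROUGH THE A₂ FRAME RULE: `endBallClassG2T := ⟨q3G2.take 8, q3G2.drop 8⟩` (T-coordinates; its contacts are NOT T-slots),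
  `hdiv_G2` (all 18 data have `3 ∣ q ⬝ (−1,−1,−1)`, `decide`), **`endBallClassG2_wf`** (`(endBallClassG2T.reflect 7).wf = true`: reflected
  across `cubeInt 7 = (−1,−1,−1)` the contacts ARE slots, `decide`), **`freeSites_G2`** (the 24 free sites of the reflected class, in
  A₂-coordinates, `decide +kernel`), **`universe_G2`**: for a carrier `z` of the 18 balls `z + G·pointVec q`, `q ∈ q3G2` (T-coordinates,
  as certified by `shellRow_G2`) with `deg z ≤ 8`, every `x ∈ X` within `√3` is `z`, one of the 18, a ball at `z + G (R (pointVec q′))`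
  for one of the 24 free sites `q′` (`R` the reflection in the plane normal to `(−1,−1,−1)`), or payer-accompanied — by
  `EndBallClass.universe_reflect`.
WHAT THIS IS NOT: no new certificate about G1/G2; F-C1 not moved.
-/

namespace Summit.Ventures.Crystal3D.Theorems

open Summit.Ventures.Crystal3D Finset NearIdentity

variable {X : Finset (EuclideanSpace ℝ (Fin 3))}

/-! ### §1 G1: one «occupied ⇒ C′» step -/

set_option maxRecDepth 200000 in
/-- **Free table of G1 after occupying the cube site `(−4,−4,−4)`:** 16 sites. -/
theorem freeSites_G1_step : (endBallClassG1.addOwn ![-4, -4, -4]).freeSites true =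
    {![-6, -3, 3],
    ![-6, 3, -3],
    ![-6, 3, 3],
    ![-4, -4, 4],
    ![-4, 4, 4],
    ![-3, -6, 3],
    ![-3, -3, 6],
    ![-3, 3, 6],
    ![-3, 6, 3],
    ![3, -6, -3],
    ![3, -6, 3],
    ![3, -3, 6],
    ![3, 6, -3],
    ![4, -4, 4],
    ![6, -3, 3],
    ![6, 3, -3]} := by
  decide +kernel

/-- **Universe theorem for G1-carriers with a ball at the cube site `(−4,−4,−4)`.** -/
theorem universe_G1_step {δ : ℝ} (hg : KissingGap δ) (hc : KissingClassification δ) (hδ : 5 / 2 ≤ δ)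
    (hX : ∀ p ∈ X, ∀ q ∈ X, p ≠ q → 1 ≤ dist p q)
    (A : EuclideanSpace ℝ (Fin 3) ≃ₗᵢ[ℝ] EuclideanSpace ℝ (Fin 3)) {z : EuclideanSpace ℝ (Fin 3)} (hz : z ∈ X)
    (hpres : ∀ q ∈ q3G1, z + A (pointVec q) ∈ X) (hocc : z + A (pointVec ![-4, -4, -4]) ∈ X)
    (hdeg : (X.filter fun y => dist z y = 1).card ≤ 8)
    {x : EuclideanSpace ℝ (Fin 3)} (hx : x ∈ X) (h3 : dist x z ≤ Real.sqrt 3) :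
    x = z ∨ (∃ q ∈ q3G1 ++ [![-4, -4, -4]], x = z + A (pointVec q)) ∨
      (∃ q ∈ (endBallClassG1.addOwn ![-4, -4, -4]).freeSites true, x = z + A (pointVec q)) ∨
      ∃ y ∈ X, y ≠ z ∧ dist x y ≤ 2 ∧ (X.filter fun q => dist y q = 1).card ≤ 11 := by
  have hcar : endBallClassG1.IsCarrier X A z := ⟨hz, by rw [endBallClassG1_listed]; exact hpres⟩
  have hlen : endBallClassG1.contacts.length = 8 := by decide
  have h := endBallClassG1.universe_addOwn endBallClassG1_wf hg hc hδ hX A hcar hocc (by rw [hlen]; exact hdeg) hx h3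
  rwa [EndBallClass.addOwn_listed, endBallClassG1_listed] at h

/-! ### §2 G2 through the A₂ frame rule -/

/-- Class G2 in interface format, T-COORDINATES (`q3G2`: 8 contacts — twin-lattice slots, not T-slots — and 10 shell balls). -/
def endBallClassG2T : EndBallClass := ⟨q3G2.take 8, q3G2.drop 8⟩

/-- The listed balls of G2 are `q3G2`. -/
theorem endBallClassG2T_listed : endBallClassG2T.listed = q3G2 := List.take_append_drop 8 q3G2

/-- G2's data are CSL-compatible for the normal `cubeInt 7 = (−1,−1,−1)`: `3 ∣ q ⬝ c` for all 18 balls. -/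
theorem hdiv_G2 : ∀ q ∈ q3G2, (3 : ℤ) ∣ sdot3 q (cubeInt 7) := by decide

/-- **Reflected across `(−1,−1,−1)`, G2 is well formed:** its contacts become eight distinct slots of the A₂ frame. -/
theorem endBallClassG2_wf : (endBallClassG2T.reflect 7).wf = true := by decide

set_option maxRecDepth 200000 in
/-- **The free table of G2** (reflected presentation, A₂-coordinates): 24 sites, all of squared length 48 or 54. -/
theorem freeSites_G2 : (endBallClassG2T.reflect 7).freeSites true =
    {![-6, -3, -3],
    ![-6, -3, 3],
    ![-6, 3, -3],
    ![-4, -4, -4],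
    ![-4, 4, -4],
    ![-3, -6, -3],
    ![-3, -6, 3],
    ![-3, -3, -6],
    ![-3, 3, -6],
    ![-3, 6, -3],
    ![-3, 6, 3],
    ![3, -6, -3],
    ![3, -3, -6],
    ![3, 3, -6],
    ![3, 3, 6],
    ![3, 6, -3],
    ![3, 6, 3],
    ![4, -4, -4],
    ![4, 4, -4],
    ![4, 4, 4],
    ![6, -3, -3],
    ![6, -3, 3],
    ![6, 3, -3],
    ![6, 3, 3]} := by
  decide +kernel

/-- **Universe theorem for carriers of G2** (data in T-coordinates, free sites in A₂-coordinates through the reflection `R`). -/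
theorem universe_G2 {δ : ℝ} (hg : KissingGap δ) (hc : KissingClassification δ) (hδ : 5 / 2 ≤ δ)
    (hX : ∀ p ∈ X, ∀ q ∈ X, p ≠ q → 1 ≤ dist p q)
    (G : EuclideanSpace ℝ (Fin 3) ≃ₗᵢ[ℝ] EuclideanSpace ℝ (Fin 3)) {z : EuclideanSpace ℝ (Fin 3)} (hz : z ∈ X)
    (hpres : ∀ q ∈ q3G2, z + G (pointVec q) ∈ X) (hdeg : (X.filter fun y => dist z y = 1).card ≤ 8)
    {x : EuclideanSpace ℝ (Fin 3)} (hx : x ∈ X) (h3 : dist x z ≤ Real.sqrt 3) :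
    x = z ∨ (∃ q ∈ q3G2, x = z + G (pointVec q)) ∨
      (∃ q' ∈ (endBallClassG2T.reflect 7).freeSites true,
        x = z + G ((ℝ ∙ ofCubic (cubeVec 7))ᗮ.reflection (pointVec q'))) ∨
      ∃ y ∈ X, y ≠ z ∧ dist x y ≤ 2 ∧ (X.filter fun q => dist y q = 1).card ≤ 11 := by
  have hcar : endBallClassG2T.IsCarrier X G z := ⟨hz, by rw [endBallClassG2T_listed]; exact hpres⟩
  have hlen : endBallClassG2T.contacts.length = 8 := by decide
  have h := endBallClassG2T.universe_reflect 7 endBallClassG2_wf (by rw [endBallClassG2T_listed]; exact hdiv_G2) hg hc hδ hX G hcar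
    (by rw [hlen]; exact hdeg) hx h3
  rwa [endBallClassG2T_listed] at h

end Summit.Ventures.Crystal3D.Theorems
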